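import Literature.AnabelianGeometry.EtaleTheta.Discharge.Sec5BNBaseGaloisLevelN

/-!
# [EtTh] Prop. 5.5 at the genuine §5 data over `B^temp(Π^tp_X)⁰`, abc-iut-L2-t9's R2 carrier at level `N`: the coefficient map `e` with `he`, `hPproj` — RECORD-FREE

Mochizuki, *The étale theta function and its Frobenioid-theoretic manifestations*, Publ. RIMS **45** (2009), §5 p. 327 (PDF p. 101)
("these subquotients determine subquotients `Aut_D(D) ↠ Aut^Θ_D(D)`; `(l·Δ_Θ)_D ⊆ Aut^Θ_D(D)`"), §2 p. 46 ("`(l·Δ_Θ) ↠ (l·Δ_Θ) ⊗ ℤ/Nℤ ≅ μ_N`"),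
proof of Prop. 5.5 pp. 327–328 (PDF pp. 101–102).  [cite: MochizukiEtTh2009, Prop 5.5 p.327–328 (PDF pp.101–102)]

PROOF-ONLY (no definitions).  abc-iut cell, seat abc-iut-w4-d042 (gen 4), O1 lineage (level-`N` parameters `(q_N, ι_N)` of
`ThetaSubquotientLevelN.lean`, p430659; genuine-`ρ` laws `Discharge/Sec5ThetaSubquotientLevelNOfConnectedTemperoid.lean`, p431034), on
abc-iut-w5-d020's hand-over (STATUS 11:10:26Z): the R2-carrier twin of abc-iut-w5-d020's `Discharge/Sec5AutImageCoefficientMapLevelN.lean`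
(p437167, print's IMAGE carrier).  Over the GENERAL connected setting `BiKummerSetting.mkOfConnectedTemperoid X tf hZ hP NH A₀ hA₀ hA₀'` of
abc-iut-L2-t4 and an `N`-th root `R` over it, at the `ρ` / `autProj` level ONLY — no `ThetaFrobenioid` record `𝔉`, no `ThetaSubquotientProj` term
`P` — so that it serves alike the `levelStub` consumers (abc-iut-w4-d042 `Discharge/Sec5Prop55OfConnectedTemperoidLevelN.lean`, p432174: `hpre`,
`hlift`, `hgeom` but not `e`/`hPproj`), abc-iut-L2-t4's planned `B_N^bs`-indexed `P` (GAP-LEDGER G-w4d042g3-1, plan (a)), and any re-typed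
record (one defeq `exact` away in each case):

* `autProj_rho_eq_of_thetaMod_eq_levelN` — `autProj (ρ k)` for `k ∈ (l·Δ_Θ)` depends only on `thetaMod k ∈ μ_N` (both sides evaluate at the
  base point `x = (s^⊓_N)^bs(x_{A_N})` to the class of `(thetaMod k)⁻¹`, abc-iut-w4-d042's `evalAt_autProj_rho_eq_thetaMod_inv`, and `evalAt`
  is injective on the connected `B_N^bs`, abc-iut-L2-t9's `evalAt_injective`);
* `exists_mem_lDeltaTheta_autProj_rho_eq_levelN` — every point of `(l·Δ_Θ ⊗ ℤ/Nℤ)_{B_N^bs}` (R2 carrier at `(q_N, ι_N)`) is `autProj (ρ k)` for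
  some `k ∈ (l·Δ_Θ)` (abc-iut-w5-d020's `autProj_surjective_base_BN_levelN`, p438430 — `B_N^bs` is Galois — and abc-iut-w4-d042's pointwise
  hgeom `exists_mem_lDeltaTheta_mapAut_rho_eq_of_mem_autPre`);
* `exists_coeffMap_autProj_levelN` — **there is `e : μ_N → (l·Δ_Θ)_{B_N^bs} ⊗ ℤ/Nℤ`, SURJECTIVE, with
  `mk (autProj ⟨ρ k, _⟩) = e (thetaMod k)` for every `k ∈ (l·Δ_Θ)`** — the binders `(e, he, hPproj)` of Prop. 5.5 for the R2 carrier,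
  ∃-packaged (no definition filed), "`(l·Δ_Θ) ↠ (l·Δ_Θ) ⊗ ℤ/Nℤ ≅ μ_N`" (p. 46) read on print's `Aut`-subquotient at `B_N^bs`.

`ρ` is read on the underlying `Π^tp_X`-set, `((Functor.mapAut R.BN.base (connectedObjects (BTemp X.Pi)).ι).comp (rhoOfBiKummerData R ιX))`,
exactly as in p431034.  Universes as in p431034 / p438430 (`RD : RigidData.{max u₀ w}`); the instance binder `[RD.iotaN.range.Normal]` is
`RigidData.iotaN_range_normal`.  Nothing of [EtTh]'s curves is asserted; typed ≠ proved for the remaining named binders of the chain; no side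
taken on [IUTchIII] Cor. 3.12.
-/

noncomputable section

namespace Literature.AnabelianGeometry.EtaleTheta

namespace ThetaFrobenioid

open CategoryTheory Opposite Literature.AlgebraicGeometry.Frobenioids Literature.AnabelianGeometry.SemiGraphs
  Literature.AnabelianGeometry.SemiGraphs.GaloisObjects

universe u₀ v₀ w

variable {K : Type u₀} [Field K] {X : SemiGraphs.TemperedArithmeticGroup.{u₀} K} {D₀ : Type u₀} [Category.{v₀} D₀]
  {V : FrdIMonoidStub.{w}} {T₀ : RealifiedDivisorMonoids (D₀ := D₀) V}
  {VD : FrdICatStub.{u₀ + 1, u₀, w} (ConnectedPart (BTemp X.Pi))}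
  {tf : TemperedFrobenioid T₀ (ConnectedPart (BTemp X.Pi)) VD} {hZ : tf.monoidType = MonoidType.Z}
  {hP : ∀ A : (ConnectedPart (BTemp X.Pi))ᵒᵖ, IsPerfect (tf.Φ.carrier A)}
  {NH : Subgroup (Field.absoluteGaloisGroup K) → tf.category → ℕ+ → Prop} {A₀ : tf.category}
  {hA₀ : PreFrobenioid.IsFrobeniusTrivial tf.toElem A₀} {hA₀' : SemiGraphs.IsGaloisObj A₀.base.obj}
  {pullFrac : ∀ {A A' : (BiKummerSetting.mkOfConnectedTemperoid X tf hZ hP NH A₀ hA₀ hA₀').C} (_ : A' ⟶ A),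
    (BiKummerSetting.mkOfConnectedTemperoid X tf hZ hP NH A₀ hA₀ hA₀').biratUnits A →
      (BiKummerSetting.mkOfConnectedTemperoid X tf hZ hP NH A₀ hA₀ hA₀').biratUnits A'}
  {lv : ℕ+}
  {θ : (BiKummerSetting.mkOfConnectedTemperoid X tf hZ hP NH A₀ hA₀ hA₀').biratUnits
    (BiKummerSetting.mkOfConnectedTemperoid X tf hZ hP NH A₀ hA₀ hA₀').Aodot}
  {Bl : (BiKummerSetting.mkOfConnectedTemperoid X tf hZ hP NH A₀ hA₀ hA₀').C}
  {Pl : (BiKummerSetting.mkOfConnectedTemperoid X tf hZ hP NH A₀ hA₀ hA₀').FractionPair θ Bl}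
  {Rl : (BiKummerSetting.mkOfConnectedTemperoid X tf hZ hP NH A₀ hA₀ hA₀').NthRoot θ Pl lv pullFrac}
  {N : ℕ+} {l' : ℕ} {RD : RigidData.{max u₀ w} N l'}
  (R : (BiKummerSetting.mkOfConnectedTemperoid X tf hZ hP NH A₀ hA₀ hA₀').NthRoot Rl.root Rl.pair N pullFrac)
  (ιX : RD.PiX ≃ₜ* X.Pi) [RD.iotaN.range.Normal]

/-- **`autProj (ρ k)` depends only on `thetaMod k ∈ μ_N`** (`k ∈ (l·Δ_Θ)`; R2 carrier at `(q_N, ι_N)`): both values evaluate at the base point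
`x = (s^⊓_N)^bs(x_{A_N})` to the class of `(thetaMod k)⁻¹` and `evalAt x` is injective on the connected `B_N^bs`.
[cite: MochizukiEtTh2009, §5 p.327 (PDF p.101); §2 p.46] -/
theorem autProj_rho_eq_of_thetaMod_eq_levelN (k₁ k₂ : RD.PiX) (hk₁ : k₁ ∈ RD.lDeltaTheta) (hk₂ : k₂ ∈ RD.lDeltaTheta)
    (hm₁ : ((Functor.mapAut R.BN.base (connectedObjects (BTemp X.Pi)).ι).comp (rhoOfBiKummerData R ιX)) k₁ ∈
      ThetaSubquotient.autPre (RD.qN ιX) RD.iotaN R.BN.base.obj)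
    (hm₂ : ((Functor.mapAut R.BN.base (connectedObjects (BTemp X.Pi)).ι).comp (rhoOfBiKummerData R ιX)) k₂ ∈
      ThetaSubquotient.autPre (RD.qN ιX) RD.iotaN R.BN.base.obj)
    (hθ : RD.thetaMod ⟨k₁, hk₁⟩ = RD.thetaMod ⟨k₂, hk₂⟩) :
    ThetaSubquotient.autProj (RD.qN ιX) RD.iotaN R.BN.base.obj ⟨_, hm₁⟩ =
      ThetaSubquotient.autProj (RD.qN ιX) RD.iotaN R.BN.base.obj ⟨_, hm₂⟩ := by
  apply ThetaSubquotient.evalAt_injective (RD.qN ιX) RD.iotaN R.BN.base.property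
    ((BiKummerSetting.NthRoot.baseIso _ R).hom.hom.hom.hom (galoisBase X.isTempered R.AN.base.obj R.αData.isGalois))
  have e₁ := evalAt_autProj_rho_eq_thetaMod_inv R ιX k₁ hk₁ hm₁
  have e₂ := evalAt_autProj_rho_eq_thetaMod_inv R ιX k₂ hk₂ hm₂
  rw [hθ] at e₁
  exact e₁.trans e₂.symm

/-- Every point of the R2 carrier `(l·Δ_Θ ⊗ ℤ/Nℤ)_{B_N^bs}` at `(q_N, ι_N)` is `autProj (ρ k)` for some `k ∈ (l·Δ_Θ)`: `autProj` is onto at the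
Galois object `B_N^bs` (abc-iut-w5-d020's `autProj_surjective_base_BN_levelN`) and every element of print's `Aut`-subgroup `P_{B_N^bs}` is a `ρ k`,
`k ∈ (l·Δ_Θ)` (hgeom pointwise).  [cite: MochizukiEtTh2009, §5 p.327 (PDF p.101)] -/
theorem exists_mem_lDeltaTheta_autProj_rho_eq_levelN (y : ThetaSubquotient.LDelta (RD.qN ιX) RD.iotaN R.BN.base.obj) :
    ∃ (k : RD.PiX) (_ : k ∈ RD.lDeltaTheta)
      (hm : ((Functor.mapAut R.BN.base (connectedObjects (BTemp X.Pi)).ι).comp (rhoOfBiKummerData R ιX)) k ∈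
        ThetaSubquotient.autPre (RD.qN ιX) RD.iotaN R.BN.base.obj),
      ThetaSubquotient.autProj (RD.qN ιX) RD.iotaN R.BN.base.obj ⟨_, hm⟩ = y := by
  obtain ⟨σ, hσ⟩ := autProj_surjective_base_BN_levelN R ιX y
  obtain ⟨k, hk, hkσ⟩ := exists_mem_lDeltaTheta_mapAut_rho_eq_of_mem_autPre R ιX σ.2
  have hm : ((Functor.mapAut R.BN.base (connectedObjects (BTemp X.Pi)).ι).comp (rhoOfBiKummerData R ιX)) k ∈
      ThetaSubquotient.autPre (RD.qN ιX) RD.iotaN R.BN.base.obj := by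
    rw [hkσ]
    exact σ.2
  refine ⟨k, hk, hm, ?_⟩
  rw [← hσ]
  congr 1
  exact Subtype.ext hkσ

/-- **The binders `(e, he, hPproj)` of Prop. 5.5 for abc-iut-L2-t9's R2 carrier at level `N`, RECORD-FREE**: there is a SURJECTIVE
`e : μ_N → (l·Δ_Θ)_{B_N^bs} ⊗ ℤ/Nℤ` (`:= (l·Δ_Θ ⊗ ℤ/Nℤ)_{B_N^bs}` modulo `N`-th powers) with `mk (autProj (ρ k)) = e (thetaMod k)` for every
`k ∈ (l·Δ_Θ)` — "`(l·Δ_Θ) ↠ (l·Δ_Θ) ⊗ ℤ/Nℤ ≅ μ_N`" (p. 46) read on print's `Aut`-subquotient at `B_N^bs` (p. 327).  `e m` is the class of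
`autProj (ρ k_m)` for any `k_m ∈ (l·Δ_Θ)` with `thetaMod k_m = m` (`thetaMod_surjective`), well defined by `autProj_rho_eq_of_thetaMod_eq_levelN`.
[cite: MochizukiEtTh2009, Prop 5.5 p.327 (PDF p.101); §2 p.46] -/
theorem exists_coeffMap_autProj_levelN :
    ∃ e : RD.mu → (ThetaSubquotient.LDelta (RD.qN ιX) RD.iotaN R.BN.base.obj ⧸
        (powMonoidHom (N : ℕ) : ThetaSubquotient.LDelta (RD.qN ιX) RD.iotaN R.BN.base.obj →*
          ThetaSubquotient.LDelta (RD.qN ιX) RD.iotaN R.BN.base.obj).range),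
      Function.Surjective e ∧
        ∀ (k : RD.PiX) (hk : k ∈ RD.lDeltaTheta)
          (hm : ((Functor.mapAut R.BN.base (connectedObjects (BTemp X.Pi)).ι).comp (rhoOfBiKummerData R ιX)) k ∈
            ThetaSubquotient.autPre (RD.qN ιX) RD.iotaN R.BN.base.obj),
          QuotientGroup.mk (ThetaSubquotient.autProj (RD.qN ιX) RD.iotaN R.BN.base.obj ⟨_, hm⟩) = e (RD.thetaMod ⟨k, hk⟩) := by
  choose g hg using RD.thetaMod_surjective
  refine ⟨fun m => QuotientGroup.mk (ThetaSubquotient.autProj (RD.qN ιX) RD.iotaN R.BN.base.obj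
      ⟨_, mapAut_rho_mem_autPre_of_mem_lDeltaTheta R ιX (g m) (g m).2⟩), ?_, ?_⟩
  · rintro ⟨y⟩
    have H := exists_mem_lDeltaTheta_autProj_rho_eq_levelN.{u₀, v₀, w} R ιX y
    obtain ⟨k, hk, hm, hky⟩ := H
    refine ⟨RD.thetaMod ⟨k, hk⟩, ?_⟩
    exact (congrArg QuotientGroup.mk (autProj_rho_eq_of_thetaMod_eq_levelN.{u₀, v₀, w} R ιX _ k (g (RD.thetaMod ⟨k, hk⟩)).2 hk
      (mapAut_rho_mem_autPre_of_mem_lDeltaTheta R ιX _ (g (RD.thetaMod ⟨k, hk⟩)).2) hm (hg (RD.thetaMod ⟨k, hk⟩)))).trans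
      (congrArg QuotientGroup.mk hky)
  · intro k hk hm
    exact congrArg QuotientGroup.mk (autProj_rho_eq_of_thetaMod_eq_levelN.{u₀, v₀, w} R ιX k _ hk (g (RD.thetaMod ⟨k, hk⟩)).2 hm
      (mapAut_rho_mem_autPre_of_mem_lDeltaTheta R ιX _ (g (RD.thetaMod ⟨k, hk⟩)).2) (hg (RD.thetaMod ⟨k, hk⟩)).symm)

end ThetaFrobenioid

end Literature.AnabelianGeometry.EtaleTheta

end
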